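/-
Soloist `solo-ValiantsHypothesis-informed`, session 19 — pair capture: the trivial bound for the width.
-/
import Mathlib
import Literature.Barriers.Langlands.TaylorWilesNumericalCoincidence
import Summits.ValiantsHypothesis.ValiantsHypothesis.Theorems.SoloInformedPairPacking

/-!
# Pair capture: the `K_{2,2}`-free count behind the trivial width bound `W ≤ b + a √b`

Setting of the soloist note `paper/quadspan.md` §7.11–7.12 (not formalised here): an NR rank-3 family
over `ℂ[[z]]` with `a` rows and `b` columns, a pattern `Γ` with one edge per (row, direction), and for
every column `j` a set `R j` of WIDTH REPRESENTATIVES — rows of `j` whose exit nodes in the digit trie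
are pairwise incomparable; `W = ∑_j |R j|` is the total flag-tree width.  The geometric input
(7.57, step (0)): two rows with incomparable exits in a column of direction `τ` are separated first in
direction `τ`, so they can be jointly captured only by columns of that one direction, and by (U) by at
most ONE column.  Hence the representative sets pairwise meet in at most one row — the representative
incidence graph is `K_{2,2}`-free — and everything below is the abstract consequence of that single
hypothesis, for an arbitrary indexed family `R : ι → Finset (Fin a)` over a finite index set `s`
(`b = s.card`):

* `soloInformed_pairCapture_choose`  : `∑ j ∈ s, C(|R j|, 2) ≤ C(a, 2)` (indexed pair packing);
* `soloInformed_pairCapture_sq`      : `W ^ 2 ≤ b · (W + 2·C(a,2))` (Cauchy–Schwarz);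
* `soloInformed_pairCapture_width`   : `W ≤ b + a · (Nat.sqrt b + 1)` — the "trivial bound"
  `W ≲ b + a√b ≤ n^{3/2}` that every refuter of (W_U) must nearly attain and that the
  Orponen–Shmerkin "trivial estimate" `|𝒯| ≳ M |P|^{1/2}` corresponds to (Remark 7.60);
* `soloInformed_pairCapture_largeColumn` : for every column `T`, the other columns representing the
  rows of `T` are pairwise distinct: `∑ i ∈ R T, (deg i − 1) ≤ b − 1` (the analogue of
  Shmerkin–Wang, Lemma 10).
-/

namespace Summit.ValiantsHypothesis.ValiantsHypothesis.Theorems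

open Finset

/-- Indexed pair packing: if the sets `R j` (`j ∈ s`) pairwise meet in at most one point then
`∑ j ∈ s, C(|R j|,2) ≤ C(a,2)`. -/
theorem soloInformed_pairCapture_choose {a : ℕ} {ι : Type*} [DecidableEq ι] (s : Finset ι)
    (R : ι → Finset (Fin a))
    (h : ∀ j ∈ s, ∀ j' ∈ s, j ≠ j' → (R j ∩ R j').card ≤ 1) :
    ∑ j ∈ s, (R j).card.choose 2 ≤ a.choose 2 := by
  classical
  set s₂ := s.filter (fun j => 2 ≤ (R j).card) with hs₂
  have hsum : ∑ j ∈ s, (R j).card.choose 2 = ∑ j ∈ s₂, (R j).card.choose 2 := by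
    rw [hs₂, Finset.sum_filter_of_ne]
    intro j _ hne
    by_contra hlt
    exact hne (Nat.choose_eq_zero_of_lt (by omega))
  have hinj : Set.InjOn R (s₂ : Set ι) := by
    intro j hj j' hj' hjj'
    simp only [hs₂, Finset.coe_filter, Set.mem_setOf_eq] at hj hj'
    by_contra hne
    have := h j hj.1 j' hj'.1 hne
    rw [hjj', Finset.inter_self] at this
    omega
  rw [hsum, ← Finset.sum_image (f := fun A : Finset (Fin a) => A.card.choose 2) hinj]
  apply soloInformed_pairPacking
  intro A hA B hB hAB
  simp only [Finset.mem_image] at hA hB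
  obtain ⟨j, hj, rfl⟩ := hA
  obtain ⟨j', hj', rfl⟩ := hB
  have hj1 : j ∈ s := (Finset.mem_filter.mp hj).1
  have hj'1 : j' ∈ s := (Finset.mem_filter.mp hj').1
  exact h j hj1 j' hj'1 (fun hjj => hAB (by rw [hjj]))

/-- Cauchy–Schwarz form of pair capture: `W² ≤ b (W + 2 C(a,2))` with `W = ∑ |R j|`, `b = |s|`. -/
theorem soloInformed_pairCapture_sq {a : ℕ} {ι : Type*} [DecidableEq ι] (s : Finset ι)
    (R : ι → Finset (Fin a))
    (h : ∀ j ∈ s, ∀ j' ∈ s, j ≠ j' → (R j ∩ R j').card ≤ 1) :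
    (∑ j ∈ s, (R j).card) ^ 2 ≤ s.card * (∑ j ∈ s, (R j).card + 2 * a.choose 2) := by
  have hcs : (∑ j ∈ s, (R j).card) ^ 2 ≤ s.card * ∑ j ∈ s, (R j).card ^ 2 :=
    sq_sum_le_card_mul_sum_sq
  have hsq : ∑ j ∈ s, (R j).card ^ 2 = ∑ j ∈ s, (R j).card + 2 * ∑ j ∈ s, (R j).card.choose 2 := by
    rw [Finset.mul_sum, ← Finset.sum_add_distrib]
    exact Finset.sum_congr rfl (fun j _ => Literature.Barriers.Langlands.sq_eq_add_two_mul_choose_two _)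
  have hpc := soloInformed_pairCapture_choose s R h
  calc (∑ j ∈ s, (R j).card) ^ 2 ≤ s.card * ∑ j ∈ s, (R j).card ^ 2 := hcs
    _ = s.card * (∑ j ∈ s, (R j).card + 2 * ∑ j ∈ s, (R j).card.choose 2) := by rw [hsq]
    _ ≤ s.card * (∑ j ∈ s, (R j).card + 2 * a.choose 2) := by gcongr

/-- The trivial width bound: `W ≤ b + a (⌊√b⌋ + 1)`. -/
theorem soloInformed_pairCapture_width {a : ℕ} {ι : Type*} [DecidableEq ι] (s : Finset ι)
    (R : ι → Finset (Fin a))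
    (h : ∀ j ∈ s, ∀ j' ∈ s, j ≠ j' → (R j ∩ R j').card ≤ 1) :
    ∑ j ∈ s, (R j).card ≤ s.card + a * (Nat.sqrt s.card + 1) := by
  have hsq := soloInformed_pairCapture_sq s R h
  set W := ∑ j ∈ s, (R j).card with hW
  set b := s.card with hb
  set r := Nat.sqrt b + 1 with hr
  have hbr : b < r * r := by
    have := Nat.lt_succ_sqrt b
    simpa [hr, Nat.succ_eq_add_one] using this
  have ha : 2 * a.choose 2 ≤ a * a := by
    have := Literature.Barriers.Langlands.sq_eq_add_two_mul_choose_two a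
    nlinarith
  by_contra hlt
  -- W ≥ b + a r + 1
  have h1 : b + a * r + 1 ≤ W := by omega
  have h2 : W * (b + a * r + 1) ≤ W * W := Nat.mul_le_mul_left _ h1
  have h3 : b * (2 * a.choose 2) ≤ a * a * (r * r) := by
    calc b * (2 * a.choose 2) ≤ b * (a * a) := Nat.mul_le_mul_left _ ha
      _ ≤ (r * r) * (a * a) := Nat.mul_le_mul_right _ hbr.le
      _ = a * a * (r * r) := by ring
  have h4 : (b + a * r + 1) * (a * r + 1) ≤ W * (a * r + 1) := Nat.mul_le_mul_right _ h1
  have h5 : a * a * (r * r) + 1 ≤ (b + a * r + 1) * (a * r + 1) := by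
    have : (b + a * r + 1) * (a * r + 1) = a * a * (r * r) + 1 + (b * (a * r) + b + 2 * (a * r)) := by
      ring
    omega
  have h6 : W * (b + a * r + 1) = W * b + W * (a * r + 1) := by ring
  have h7 : W ^ 2 = W * W := sq W
  have h8 : b * (W + 2 * a.choose 2) = W * b + b * (2 * a.choose 2) := by ring
  rw [h7, h8] at hsq
  omega

/-- Large-column bound (Shmerkin–Wang Lemma 10 analogue): for a fixed column `T ∈ s`, the columns
`j ≠ T` representing rows of `T` are pairwise distinct across those rows, so
`∑ i ∈ R T, (#{j ∈ s | i ∈ R j} − 1) ≤ b − 1`. -/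
theorem soloInformed_pairCapture_largeColumn {a : ℕ} {ι : Type*} [DecidableEq ι] (s : Finset ι)
    (R : ι → Finset (Fin a))
    (h : ∀ j ∈ s, ∀ j' ∈ s, j ≠ j' → (R j ∩ R j').card ≤ 1) (T : ι) (hT : T ∈ s) :
    ∑ i ∈ R T, ((s.filter (fun j => i ∈ R j)).card - 1) ≤ s.card - 1 := by
  classical
  -- the sets D i := {j ∈ s | j ≠ T, i ∈ R j}, i ∈ R T, are pairwise disjoint subsets of s \ {T}
  set D : Fin a → Finset ι := fun i => (s.erase T).filter (fun j => i ∈ R j) with hD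
  have hcard : ∀ i ∈ R T, (s.filter (fun j => i ∈ R j)).card - 1 ≤ (D i).card := by
    intro i hi
    have : s.filter (fun j => i ∈ R j) ⊆ insert T (D i) := by
      intro j hj
      rw [Finset.mem_filter] at hj
      rw [Finset.mem_insert]
      by_cases hjT : j = T
      · exact Or.inl hjT
      · right
        simp only [hD, Finset.mem_filter, Finset.mem_erase]
        exact ⟨⟨hjT, hj.1⟩, hj.2⟩
    have := (Finset.card_le_card this).trans (Finset.card_insert_le _ _)
    omega
  have hdisj : ∀ i ∈ R T, ∀ i' ∈ R T, i ≠ i' → Disjoint (D i) (D i') := by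
    intro i hi i' hi' hii'
    rw [Finset.disjoint_left]
    intro j hj hj'
    simp only [hD, Finset.mem_filter, Finset.mem_erase] at hj hj'
    have hle := h j hj.1.2 T hT hj.1.1
    have h2 : 2 ≤ (R j ∩ R T).card := by
      have hsub : ({i, i'} : Finset (Fin a)) ⊆ R j ∩ R T := by
        intro x hx
        simp only [Finset.mem_insert, Finset.mem_singleton] at hx
        rcases hx with rfl | rfl
        · exact Finset.mem_inter.mpr ⟨hj.2, hi⟩
        · exact Finset.mem_inter.mpr ⟨hj'.2, hi'⟩
      have := Finset.card_le_card hsub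
      rwa [Finset.card_pair hii'] at this
    omega
  calc ∑ i ∈ R T, ((s.filter (fun j => i ∈ R j)).card - 1)
      ≤ ∑ i ∈ R T, (D i).card := Finset.sum_le_sum hcard
    _ = ((R T).biUnion D).card := (Finset.card_biUnion hdisj).symm
    _ ≤ (s.erase T).card := Finset.card_le_card (by
        intro j hj
        simp only [Finset.mem_biUnion, hD, Finset.mem_filter] at hj
        obtain ⟨i, _, hji, _⟩ := hj
        exact hji)
    _ = s.card - 1 := Finset.card_erase_of_mem hT

end Summit.ValiantsHypothesis.ValiantsHypothesis.Theorems
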